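/-
Copyright (c) 2026 the pub-hodgecm-mathlib formalisation cell (harness21).  Prover seat hodgecm-mathlib-LH7-p09 (g2), CLOSE-OUT ROSTER strike line L3∕L5 (Track A
«(D-RAM) FOUR-FRAME» squad F0∕P3c∕LH4 ∕ F0∕P3c∕LH7); β₂-BOARD v2 row (OFF) (lead LH7-p09 (g2); assembler LH4-p12 (g8) ED. 3 «parity-aware», PARITY NOTE 23:14:16Z);
helper lane on h413 = stmt-HodgeConjecture-24833 (count-neutral).  2026-09-04.
-/
import Summits.HodgeConjecture.HodgeConjecture.Theorems.F0P3cDyRamDeepConeCellOffShell     -- ★ p862651 (this seat): the level-1 case; brings ★ p862572 coordinates, ★ `…ShellLineModel`, ★ p862037 transports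
import HarnessLib

/-!
# Crux `H413`, line LH4 «(D-RAM) FOUR-FRAME» — the (β₂) road (R-36), β₂-BOARD v2 row (OFF): «A DEEP CONE CELL IS OFF EVERY SHELL, LEVEL BY LEVEL, AND THE LOWER ANTI-DIAGONAL
# SITS ON LEVEL EXACTLY ZERO» — the parity-aware form of ★ p862651 for the (OFF) assembly ED. 3 of LH4-p12 (g8) (shell index `ℓ₀ = d % 2`, any `q`, any `d`)

Cell `hodgecm-mathlib` (D-0151), FLOOR 0, crux item H413 = `stmt-HodgeConjecture-24833`, route of record `HCCMUnconditional`; squads F0∕P3c∕LH4 ∕ LH7; lane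
`--supports stmt-HodgeConjecture-24833 --as helper` (count-neutral; pays NO tier-0 row).  THEOREMS ONLY (no `def`, no instance, no notation, no `sorry`, default heartbeats);
★-only imports; states NO law; (β₂) stays a HYPOTHESIS.  DATUM-FREE: line model `(M, jE, ρ, α)` and ★ `…ShellLineModel`'s glued-vertex letters, as in ★ p862651.

WHY (LH4-p12 (g8) PARITY NOTE 23:14:16Z on the (OFF) sockets).  ★ p862651 puts every glued vertex over a DEEP cell (`2b < m₀`, `j + b < jl′`) on level `≥ 1`, which is off
the `ℓ₀ = 0` shell (even `d`) but is exactly the level token of the `ℓ₀ = 1` shell (odd `d`).  In the `Fix ρ`-coordinates of ★ p862572 the same estimate runs one digit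
deeper per digit of depth: `|BP| ≤ |ϖE|^{jl′ + b}`, `|AQ| ≤ |ϖE|^{m₀ + j}`, and LEVEL `≥ L` of `Γ − 1` reads `|BP − AQ| ≤ |ϖE|^{j + 2b + L}`.  Hence:
* §1 `v_div_sub_map_div_le_of_deep_level` ∕ `isOrd_div_pow_mul_of_deep_level` — DEEP BY `L` (`|μ| ≤ |ϖE|^{2b+L}`, `|μ − ρμ| ≤ |cc(α − ρα)|·|ϖE|^{b+L}`) ⇒
  `IsOrd cc (μ∕(ϖE^L·Y))`; §2 HEAD `latticeInLevel_endoGL_sub_one_of_deep_level` (`LatticeInLevel ϖ L (Γ − 1) L₃`) and `not_latticeNearTransvShell_of_deep_level`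
  (`¬ LatticeNearTransvShell ϖ ℓ₀ mc (Γ − 1) L₃` from the letters at `L := ℓ₀ + 1`) — so the (OFF) socket `hE1` is paid at shell index `d % 2` WITHOUT a parity case:
  DEEP = `j + b + d % 2 < jl′ ∧ 2b + d % 2 < m₀`.
* §3 THE LOWER ANTI-DIAGONAL `j + b = jl′` (`2b < m₀`, `b < j`) SITS ON LEVEL EXACTLY ZERO: `|BP| = |cc|·|ϖE|^{2b}` EXACTLY dominates `|AQ|`, so the level-1 token FAILS
  (`not_isOrd_div_mul_of_antidiagonal`, HEAD `not_latticeInLevel_one_endoGL_sub_one_of_antidiagonal`, `not_latticeNearTransvShell_one_of_antidiagonal`): at ODD `d`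
  this strip carries NO vertex of either label (it is the live balanced LOWER line only at even `d`; at odd `d` the balanced line is `j + b + 1 = jl′`).
HONEST LABEL.  Count-neutral valuation algebra; nothing printed is asserted; no census law is stated; `HC_CM` is proved only modulo the 7 printed citations (2 remaining named inputs:
hLiu418 = `stmt-HodgeConjecture-24832`, h413 = `stmt-HodgeConjecture-24833`) until rung 0 closes.
## References
* [Serre1979] J.-P. Serre, *Local Fields*, GTM 67 (1979): Ch. III §6 Prop. 12 (orders of conductor `c`).
* [Kottwitz1986BaseChangeUnits] R. E. Kottwitz, *Base change for unit elements of Hecke algebras*, Compositio Math. 60 (1986): §1 pp. 240–241, §3 (congruence levels on lattices).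
* [Jacobowitz1962] R. Jacobowitz, *Hermitian forms over local fields*, Amer. J. Math. 84 (1962): §4 (duals, gluing).
* [Rogawski1990] J. D. Rogawski, *Automorphic Representations of Unitary Groups in Three Variables*, Ann. of Math. Stud. 123 (1990): §4.9 Prop. 4.9.1 (b) p. 55.
-/

set_option autoImplicit false

noncomputable section
namespace Summit.HodgeConjecture.HodgeConjecture.Cruxes.H413.F0P3cDyRamDeepConeCellOffShellLevel

open scoped Valued WithZero Matrix MatrixGroups
open WithZero
open Literature.NumberTheory.Automorphic Literature.NumberTheory.Automorphic.HermitianLattice Literature.NumberTheory.Automorphic.UnitaryLatticeTree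
open Literature.NumberTheory.Rogawski1990
open Summit.HodgeConjecture.HodgeConjecture.Cruxes.H413.F0P3cDyRamToricCensusDefs
open Summit.HodgeConjecture.HodgeConjecture.Cruxes.H413.F0P3cDyRamFourFrameCensusDefs (LatticeInLevel LatticeNearTransvShell)
open Summit.HodgeConjecture.HodgeConjecture.Cruxes.H413.F0P3cDyRamShellLineModel (latticeInLevel_endoGL_sub_one_iff_isOrd)
open Summit.HodgeConjecture.HodgeConjecture.Cruxes.H413.F0P3cDyRamBoundaryCellLetterCardTwo (v_map_lt_one_iff_of_le_iff)
open Summit.HodgeConjecture.HodgeConjecture.Cruxes.H413.F0P3cDyRamRayDominatedCellLetter (v_map_le_map_pow_of_le)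
open Summit.HodgeConjecture.HodgeConjecture.Cruxes.H413.F0P3cDyRamTerminalCellOffShellCardTwo (mul_map_sub_mul_map_eq)

variable {E M : Type} [Field E] [Valued E ℤᵐ⁰] [Field M] [Valued M ℤᵐ⁰] {ρ : M →+* M} {α : M}
/-! ## §1 DEEP BY `L`: the depth quotient lies `L` digits inside the order -/

/-- **THE DEEP DIGITS (any `q`, any level `L`).**  Line model: `ρ` isometric, `ρα ≠ α`, `|α| ≤ 1`, `|ϖ| = exp(−1)`, `|jE c| ≤ 1 ↔ |c| ≤ 1`.  CELL: `Y ∈ 𝒪_cc`, `|Y| = |ϖE|^b`,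
`|cc| ≤ |ϖE|^b`.  DEEP-BY-`L` letters: `|μ| ≤ |ϖE|^{2b+L}` and `|μ − ρμ| ≤ |cc(α − ρα)|·|ϖE|^{b+L}`.  THEN `|μ∕Y − ρ(μ∕Y)| ≤ |cc(α − ρα)|·|ϖE|^L`.
[cite: Serre1979, Ch. III §6 Prop. 12] [cite: Kottwitz1986BaseChangeUnits, §1 pp. 240–241] -/
theorem v_div_sub_map_div_le_of_deep_level
    (hvρ : ∀ x, Valued.v (ρ x) = Valued.v x) (hα : ρ α ≠ α) (hα1 : Valued.v α ≤ 1)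
    (jE : E →+* M) (hjv : ∀ c, Valued.v (jE c) ≤ 1 ↔ Valued.v c ≤ 1) {ϖ : E} (hϖ : Valued.v ϖ = exp (-1 : ℤ))
    {cc : M} {Y : M} (hYO : IsOrd ρ α cc Y) {b : ℕ} (hYb : Valued.v Y = Valued.v (jE ϖ) ^ b) (hcb : Valued.v cc ≤ Valued.v (jE ϖ) ^ b)
    (L : ℕ) {μ : M} (hμ : Valued.v μ ≤ Valued.v (jE ϖ) ^ (2 * b + L)) (hanti : Valued.v (μ - ρ μ) ≤ Valued.v (cc * (α - ρ α)) * Valued.v (jE ϖ) ^ (b + L)) :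
    Valued.v (μ / Y - ρ (μ / Y)) ≤ Valued.v (cc * (α - ρ α)) * Valued.v (jE ϖ) ^ L := by
  have hα0 : α - ρ α ≠ 0 := sub_ne_zero.2 (Ne.symm hα)
  have hvα0 : Valued.v (α - ρ α) ≠ 0 := (Valuation.ne_zero_iff _).2 hα0
  have hvαpos : 0 < Valued.v (α - ρ α) := zero_lt_iff.2 hvα0
  have hvϖ0 : Valued.v ϖ ≠ 0 := by rw [hϖ]; exact exp_ne_zero
  have hϖ0 : ϖ ≠ 0 := fun h0 => hvϖ0 (by rw [h0, map_zero])
  have hϖlt : Valued.v ϖ < 1 := by rw [hϖ, ← exp_zero, exp_lt_exp]; norm_num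
  have hjϖ0 : jE ϖ ≠ 0 := (map_ne_zero jE).2 hϖ0
  have hvjϖ0 : Valued.v (jE ϖ) ≠ 0 := (Valuation.ne_zero_iff _).2 hjϖ0
  have hvjϖpos : 0 < Valued.v (jE ϖ) := zero_lt_iff.2 hvjϖ0
  have hjϖle : Valued.v (jE ϖ) ≤ 1 := ((v_map_lt_one_iff_of_le_iff jE hjv ϖ).2 hϖlt).le
  have hY0 : Y ≠ 0 := fun h0 => by
    rw [h0, Valuation.map_zero] at hYb
    exact pow_ne_zero b hvjϖ0 hYb.symm
  have hρY0 : ρ Y ≠ 0 := (map_ne_zero ρ).2 hY0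
  -- coordinates over `Fix ρ` (sizes only)
  set B : M := (μ - ρ μ) / (α - ρ α) with hBdef
  set Q : M := (Y - ρ Y) / (α - ρ α) with hQdef
  set A : M := μ - B * α with hAdef
  set P : M := Y - Q * α with hPdef
  clear_value A P
  clear_value B Q
  have hvB : Valued.v B ≤ Valued.v cc * Valued.v (jE ϖ) ^ (b + L) := by
    rw [hBdef, Valuation.map_div, div_le_iff₀ hvαpos]
    calc Valued.v (μ - ρ μ) ≤ Valued.v (cc * (α - ρ α)) * Valued.v (jE ϖ) ^ (b + L) := hanti
      _ = Valued.v cc * Valued.v (jE ϖ) ^ (b + L) * Valued.v (α - ρ α) := by rw [Valuation.map_mul]; ac_rfl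
  have hvQ : Valued.v Q ≤ Valued.v cc := by
    rw [hQdef, Valuation.map_div, div_le_iff₀ hvαpos, ← Valuation.map_mul]
    exact hYO.2
  have hvP : Valued.v P ≤ Valued.v (jE ϖ) ^ b := by
    rw [hPdef]
    refine (Valuation.map_sub _ _ _).trans (max_le hYb.le ?_)
    rw [Valuation.map_mul]
    calc Valued.v Q * Valued.v α ≤ Valued.v cc * 1 := mul_le_mul' hvQ hα1
      _ = Valued.v cc := mul_one _
      _ ≤ Valued.v (jE ϖ) ^ b := hcb
  have hvA : Valued.v A ≤ Valued.v (jE ϖ) ^ (2 * b + L) := by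
    rw [hAdef]
    refine (Valuation.map_sub _ _ _).trans (max_le hμ ?_)
    rw [Valuation.map_mul]
    calc Valued.v B * Valued.v α ≤ Valued.v cc * Valued.v (jE ϖ) ^ (b + L) * 1 := mul_le_mul' hvB hα1
      _ = Valued.v cc * Valued.v (jE ϖ) ^ (b + L) := mul_one _
      _ ≤ Valued.v (jE ϖ) ^ b * Valued.v (jE ϖ) ^ (b + L) := mul_le_mul_left hcb _
      _ = Valued.v (jE ϖ) ^ (2 * b + L) := by rw [← pow_add]; congr 1; omega
  have hBP : Valued.v (B * P) ≤ Valued.v cc * Valued.v (jE ϖ) ^ (2 * b + L) := by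
    rw [Valuation.map_mul]
    calc Valued.v B * Valued.v P ≤ Valued.v cc * Valued.v (jE ϖ) ^ (b + L) * Valued.v (jE ϖ) ^ b := mul_le_mul' hvB hvP
      _ = Valued.v cc * Valued.v (jE ϖ) ^ (2 * b + L) := by rw [mul_assoc, ← pow_add]; congr 2; omega
  have hAQ : Valued.v (A * Q) ≤ Valued.v cc * Valued.v (jE ϖ) ^ (2 * b + L) := by
    rw [Valuation.map_mul, mul_comm]
    exact mul_le_mul' hvQ hvA
  have hdiff : Valued.v (B * P - A * Q) ≤ Valued.v cc * Valued.v (jE ϖ) ^ (2 * b + L) :=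
    (Valuation.map_sub _ _ _).trans (max_le hBP hAQ)
  have hident : μ / Y - ρ (μ / Y) = (B * P - A * Q) * (α - ρ α) / (Y * ρ Y) := by
    rw [map_div₀, div_sub_div _ _ hY0 hρY0, mul_map_sub_mul_map_eq hα hBdef hAdef hQdef hPdef]
  rw [hident, Valuation.map_div, Valuation.map_mul, Valuation.map_mul, hvρ, hYb,
    div_le_iff₀ (mul_pos (pow_pos hvjϖpos _) (pow_pos hvjϖpos _))]
  calc Valued.v (B * P - A * Q) * Valued.v (α - ρ α)
      ≤ Valued.v cc * Valued.v (jE ϖ) ^ (2 * b + L) * Valued.v (α - ρ α) := mul_le_mul_left hdiff _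
    _ = Valued.v (cc * (α - ρ α)) * Valued.v (jE ϖ) ^ L * (Valued.v (jE ϖ) ^ b * Valued.v (jE ϖ) ^ b) := by
          rw [Valuation.map_mul, pow_add, two_mul, pow_add]; ac_rfl

/-- **THE DEEP CELL'S DEPTH QUOTIENT LIES `L` DIGITS INSIDE THE ORDER**: under the letters of `v_div_sub_map_div_le_of_deep_level` (+ `ρ(ϖE) = ϖE`),
`IsOrd ρ α cc (μ ∕ (ϖE^L·Y))` — the third clause of ★ `…ShellLineModel.latticeInLevel_endoGL_sub_one_iff_isOrd` at level `L`.
[cite: Serre1979, Ch. III §6 Prop. 12] [cite: Kottwitz1986BaseChangeUnits, §3] -/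
theorem isOrd_div_pow_mul_of_deep_level
    (hvρ : ∀ x, Valued.v (ρ x) = Valued.v x) (hα : ρ α ≠ α) (hα1 : Valued.v α ≤ 1)
    (jE : E →+* M) (hjv : ∀ c, Valued.v (jE c) ≤ 1 ↔ Valued.v c ≤ 1) {ϖ : E} (hϖ : Valued.v ϖ = exp (-1 : ℤ)) (hρϖ : ρ (jE ϖ) = jE ϖ)
    {cc : M} {Y : M} (hYO : IsOrd ρ α cc Y) {b : ℕ} (hYb : Valued.v Y = Valued.v (jE ϖ) ^ b) (hcb : Valued.v cc ≤ Valued.v (jE ϖ) ^ b)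
    (L : ℕ) {μ : M} (hμ : Valued.v μ ≤ Valued.v (jE ϖ) ^ (2 * b + L)) (hanti : Valued.v (μ - ρ μ) ≤ Valued.v (cc * (α - ρ α)) * Valued.v (jE ϖ) ^ (b + L)) :
    IsOrd ρ α cc (μ / (jE ϖ ^ L * Y)) := by
  have key := v_div_sub_map_div_le_of_deep_level hvρ hα hα1 jE hjv hϖ hYO hYb hcb L hμ hanti
  have hvϖ0 : Valued.v ϖ ≠ 0 := by rw [hϖ]; exact exp_ne_zero
  have hϖ0 : ϖ ≠ 0 := fun h0 => hvϖ0 (by rw [h0, map_zero])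
  have hϖlt : Valued.v ϖ < 1 := by rw [hϖ, ← exp_zero, exp_lt_exp]; norm_num
  have hjϖ0 : jE ϖ ≠ 0 := (map_ne_zero jE).2 hϖ0
  have hvjϖ0 : Valued.v (jE ϖ) ≠ 0 := (Valuation.ne_zero_iff _).2 hjϖ0
  have hvjϖpos : 0 < Valued.v (jE ϖ) := zero_lt_iff.2 hvjϖ0
  have hjϖle : Valued.v (jE ϖ) ≤ 1 := ((v_map_lt_one_iff_of_le_iff jE hjv ϖ).2 hϖlt).le
  have hpL0 : jE ϖ ^ L ≠ 0 := pow_ne_zero L hjϖ0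
  have hvpLpos : 0 < Valued.v (jE ϖ ^ L) := zero_lt_iff.2 ((Valuation.ne_zero_iff _).2 hpL0)
  have hρpL : ρ (jE ϖ ^ L) = jE ϖ ^ L := by rw [map_pow, hρϖ]
  have hY0 : Y ≠ 0 := fun h0 => by
    rw [h0, Valuation.map_zero] at hYb
    exact pow_ne_zero b hvjϖ0 hYb.symm
  have hρY0 : ρ Y ≠ 0 := (map_ne_zero ρ).2 hY0
  refine ⟨?_, ?_⟩
  · rw [Valuation.map_div, Valuation.map_mul, hYb, Valuation.map_pow, div_le_one₀ (mul_pos (pow_pos hvjϖpos _) (pow_pos hvjϖpos _)),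
      ← pow_add]
    exact hμ.trans (pow_le_pow_right_of_le_one' hjϖle (by omega))
  · have e : μ / (jE ϖ ^ L * Y) - ρ (μ / (jE ϖ ^ L * Y)) = (μ / Y - ρ (μ / Y)) / jE ϖ ^ L := by
      rw [map_div₀, map_div₀, map_mul, hρpL]
      field_simp
    rw [e, Valuation.map_div, div_le_iff₀ hvpLpos, Valuation.map_pow]
    exact key
/-! ## §2 HEAD — every glued vertex over a deep-by-`L` cell is on level `L`, hence on no `(L − 1)`-shell -/

/-- **HEAD — «A DEEP CONE CELL IS ON LEVEL `L`» (any `q`).**  Frame: ★ `…ShellLineModel.latticeInLevel_endoGL_sub_one_iff_isOrd`'s glued-vertex letters VERBATIM + `Fix ρ ⊇ jE(E)`;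
CELL `hYO hYb hcb` (`cc = ϖE^j`, `j ≥ b`); the literal's `hum : |u₀₀ − 1| ≤ |ϖ^{m′}|` with `L ≤ m′`; DEEP-BY-`L` letters `hμ : |lam − jE u₀₀| ≤ |ϖE|^{2b+L}`,
`hanti : |μ − ρμ| ≤ |cc(α − ρα)|·|ϖE|^{b+L}`.  THEN `LatticeInLevel ϖ L (Γ − 1) L₃`, `Γ = endoGL (γ₂, u)` (★ p862651 is `L = 1`).
[cite: Kottwitz1986BaseChangeUnits, §3] [cite: Serre1979, Ch. III §6 Prop. 12] [cite: Jacobowitz1962, §4] -/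
theorem latticeInLevel_endoGL_sub_one_of_deep_level
    (hvρ : ∀ x, Valued.v (ρ x) = Valued.v x) (hα : ρ α ≠ α) (hα1 : Valued.v α ≤ 1)
    {ϖ : E} (hϖ : Valued.v ϖ = exp (-1 : ℤ))
    (jE : E →+* M) (hjv : ∀ c, Valued.v (jE c) ≤ 1 ↔ Valued.v c ≤ 1) (hjfix : ∀ z, ρ z = z ↔ ∃ c, jE c = z)
    (φ : (Fin 2 → E) →+ M) (hφs : ∀ (c : E) (x : Fin 2 → E), φ (c • x) = jE c * φ x) (hφi : Function.Injective φ)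
    {γ₂ : GL (Fin 2) E} {lam : M} (hφγ : ∀ x, φ ((γ₂ : Matrix (Fin 2) (Fin 2) E) *ᵥ x) = lam * φ x)
    {L₃ : Submodule 𝒪[E] (Fin 3 → E)} {b : ℕ} (hb : ∀ a : E, (Pi.single 1 a : Fin 3 → E) ∈ L₃ ↔ Valued.v a ≤ Valued.v ϖ ^ b)
    (hpr : ∀ x ∈ L₃, Valued.v (x 1) * Valued.v ϖ ^ b ≤ 1)
    {B₂ : Submodule 𝒪[E] (Fin 2 → E)} {w₀ : Fin 2 → E} {g₀ : Fin 3 → E}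
    (hB : B₂.map ((Matrix.toLin' (!![1, 0; 0, 0; 0, 1] : Matrix (Fin 3) (Fin 2) E)).restrictScalars 𝒪[E]) =
      L₃ ⊓ LinearMap.ker ((LinearMap.proj (1 : Fin 3) : (Fin 3 → E) →ₗ[E] E).restrictScalars 𝒪[E]))
    (hg₀ : g₀ ∈ L₃) (hg₀1 : Valued.v (g₀ 1) * Valued.v ϖ ^ b = 1) (hprg : g₀ - Pi.single 1 (g₀ 1) = ![w₀ 0, 0, w₀ 1])
    {Λ : AddSubgroup M} (hBΛ : B₂.toAddSubgroup.map φ = Λ) {cc x₀ Y : M} (hx₀ : x₀ ≠ 0)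
    (hΛx : ∀ x, x ∈ Λ ↔ ∃ z, IsOrd ρ α cc z ∧ x = x₀ * z) (hw₀Y : φ w₀ = Y⁻¹ * x₀)
    (hYO : IsOrd ρ α cc Y) (hYb : Valued.v Y = Valued.v (jE ϖ) ^ b) (hcb : Valued.v cc ≤ Valued.v (jE ϖ) ^ b)
    (u : GL (Fin 1) E) (L : ℕ) {m' : ℕ} (hLm : L ≤ m') (hum : Valued.v ((u : Matrix (Fin 1) (Fin 1) E) 0 0 - 1) ≤ Valued.v (ϖ ^ m'))
    (hμ : Valued.v (lam - jE ((u : Matrix (Fin 1) (Fin 1) E) 0 0)) ≤ Valued.v (jE ϖ) ^ (2 * b + L))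
    (hanti : Valued.v ((lam - jE ((u : Matrix (Fin 1) (Fin 1) E) 0 0)) - ρ (lam - jE ((u : Matrix (Fin 1) (Fin 1) E) 0 0))) ≤
      Valued.v (cc * (α - ρ α)) * Valued.v (jE ϖ) ^ (b + L)) :
    LatticeInLevel ϖ L ((((endoGL (γ₂, u) : GL (Fin 3) E) : Matrix (Fin 3) (Fin 3) E) - 1)) L₃ := by
  have hvϖ0 : Valued.v ϖ ≠ 0 := by rw [hϖ]; exact exp_ne_zero
  have hϖ0 : ϖ ≠ 0 := fun h0 => hvϖ0 (by rw [h0, map_zero])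
  have hϖlt : Valued.v ϖ < 1 := by rw [hϖ, ← exp_zero, exp_lt_exp]; norm_num
  have hjϖ0 : jE ϖ ≠ 0 := (map_ne_zero jE).2 hϖ0
  have hvjϖ0 : Valued.v (jE ϖ) ≠ 0 := (Valuation.ne_zero_iff _).2 hjϖ0
  have hjϖle : Valued.v (jE ϖ) ≤ 1 := ((v_map_lt_one_iff_of_le_iff jE hjv ϖ).2 hϖlt).le
  have hρϖ : ρ (jE ϖ) = jE ϖ := (hjfix _).2 ⟨ϖ, rfl⟩
  have hpL0 : jE ϖ ^ L ≠ 0 := pow_ne_zero L hjϖ0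
  have hvpLpos : 0 < Valued.v (jE ϖ ^ L) := zero_lt_iff.2 ((Valuation.ne_zero_iff _).2 hpL0)
  have hρpL : ρ (jE ϖ ^ L) = jE ϖ ^ L := by rw [map_pow, hρϖ]
  have hY0 : Y ≠ 0 := fun h0 => by
    rw [h0, Valuation.map_zero] at hYb
    exact pow_ne_zero b hvjϖ0 hYb.symm
  -- the literal's `u`-part is `ϖ^L`-close to `1`
  have humL : Valued.v ((u : Matrix (Fin 1) (Fin 1) E) 0 0 - 1) ≤ Valued.v ϖ ^ L :=
    hum.trans (by rw [Valuation.map_pow]; exact pow_le_pow_right_of_le_one' hϖlt.le hLm)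
  have hjum : Valued.v (jE ((u : Matrix (Fin 1) (Fin 1) E) 0 0) - 1) ≤ Valued.v (jE ϖ) ^ L := by
    have h := v_map_le_map_pow_of_le jE hjv hϖ0 humL
    rwa [map_sub, map_one] at h
  -- `|μ| ≤ |ϖE|^L`, `|μ − ρμ| ≤ |cc(α − ρα)|·|ϖE|^L`
  have hμle : Valued.v (lam - jE ((u : Matrix (Fin 1) (Fin 1) E) 0 0)) ≤ Valued.v (jE ϖ) ^ L :=
    hμ.trans (pow_le_pow_right_of_le_one' hjϖle (by omega))
  have hantile : Valued.v ((lam - jE ((u : Matrix (Fin 1) (Fin 1) E) 0 0)) - ρ (lam - jE ((u : Matrix (Fin 1) (Fin 1) E) 0 0))) ≤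
      Valued.v (cc * (α - ρ α)) * Valued.v (jE ϖ) ^ L :=
    hanti.trans (mul_le_mul_right (pow_le_pow_right_of_le_one' hjϖle (by omega)) _)
  rw [latticeInLevel_endoGL_sub_one_iff_isOrd hvρ hϖ jE φ hφs hφi hφγ hb hpr hB hg₀ hg₀1 hprg hBΛ hx₀ hY0 hΛx hw₀Y u L]
  refine ⟨by rw [Valuation.map_pow]; exact humL, ?_, ?_⟩
  · -- `IsOrd cc ((lam − 1)∕ϖE^L)`
    have hρu : ρ (jE ((u : Matrix (Fin 1) (Fin 1) E) 0 0)) = jE ((u : Matrix (Fin 1) (Fin 1) E) 0 0) := (hjfix _).2 ⟨_, rfl⟩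
    have hsplit : lam - 1 = (lam - jE ((u : Matrix (Fin 1) (Fin 1) E) 0 0)) + (jE ((u : Matrix (Fin 1) (Fin 1) E) 0 0) - 1) := by ring
    refine ⟨?_, ?_⟩
    · rw [Valuation.map_div, Valuation.map_pow, div_le_one₀ (by rw [← Valuation.map_pow]; exact hvpLpos), hsplit]
      exact (Valuation.map_add _ _ _).trans (max_le hμle hjum)
    · have e : (lam - 1) / jE ϖ ^ L - ρ ((lam - 1) / jE ϖ ^ L) =
          ((lam - jE ((u : Matrix (Fin 1) (Fin 1) E) 0 0)) - ρ (lam - jE ((u : Matrix (Fin 1) (Fin 1) E) 0 0))) / jE ϖ ^ L := by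
        rw [map_div₀, map_sub, map_one, hρpL, map_sub, hρu]
        field_simp
        ring
      rw [e, Valuation.map_div, Valuation.map_pow, div_le_iff₀ (by rw [← Valuation.map_pow]; exact hvpLpos)]
      exact hantile
  · exact isOrd_div_pow_mul_of_deep_level hvρ hα hα1 jE hjv hϖ hρϖ hYO hYb hcb L hμ hanti

/-- **HEAD — «A DEEP CONE CELL IS OFF THE `ℓ₀`-SHELL» (any `q`, any parity).**  Same frame; DEEP-BY-`(ℓ₀ + 1)` letters (`|μ| ≤ |ϖE|^{2b+ℓ₀+1}`,
`|μ − ρμ| ≤ |cc(α − ρα)|·|ϖE|^{b+ℓ₀+1}`, `ℓ₀ + 1 ≤ m′`): for EVERY square level `mc`, `¬ LatticeNearTransvShell ϖ ℓ₀ mc (Γ − 1) L₃`.  At `ℓ₀ = d % 2` the (OFF)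
socket «DEEP cells pay 0» (`j + b + d % 2 < jl′`, `2b + d % 2 < m₀`) follows at both parities through ★ p862869's junction.
[cite: Kottwitz1986BaseChangeUnits, §3] [cite: Rogawski1990, §4.9 Prop. 4.9.1 (b) p. 55] [cite: Serre1979, Ch. III §6 Prop. 12] -/
theorem not_latticeNearTransvShell_of_deep_level
    (hvρ : ∀ x, Valued.v (ρ x) = Valued.v x) (hα : ρ α ≠ α) (hα1 : Valued.v α ≤ 1)
    {ϖ : E} (hϖ : Valued.v ϖ = exp (-1 : ℤ))
    (jE : E →+* M) (hjv : ∀ c, Valued.v (jE c) ≤ 1 ↔ Valued.v c ≤ 1) (hjfix : ∀ z, ρ z = z ↔ ∃ c, jE c = z)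
    (φ : (Fin 2 → E) →+ M) (hφs : ∀ (c : E) (x : Fin 2 → E), φ (c • x) = jE c * φ x) (hφi : Function.Injective φ)
    {γ₂ : GL (Fin 2) E} {lam : M} (hφγ : ∀ x, φ ((γ₂ : Matrix (Fin 2) (Fin 2) E) *ᵥ x) = lam * φ x)
    {L₃ : Submodule 𝒪[E] (Fin 3 → E)} {b : ℕ} (hb : ∀ a : E, (Pi.single 1 a : Fin 3 → E) ∈ L₃ ↔ Valued.v a ≤ Valued.v ϖ ^ b)
    (hpr : ∀ x ∈ L₃, Valued.v (x 1) * Valued.v ϖ ^ b ≤ 1)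
    {B₂ : Submodule 𝒪[E] (Fin 2 → E)} {w₀ : Fin 2 → E} {g₀ : Fin 3 → E}
    (hB : B₂.map ((Matrix.toLin' (!![1, 0; 0, 0; 0, 1] : Matrix (Fin 3) (Fin 2) E)).restrictScalars 𝒪[E]) =
      L₃ ⊓ LinearMap.ker ((LinearMap.proj (1 : Fin 3) : (Fin 3 → E) →ₗ[E] E).restrictScalars 𝒪[E]))
    (hg₀ : g₀ ∈ L₃) (hg₀1 : Valued.v (g₀ 1) * Valued.v ϖ ^ b = 1) (hprg : g₀ - Pi.single 1 (g₀ 1) = ![w₀ 0, 0, w₀ 1])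
    {Λ : AddSubgroup M} (hBΛ : B₂.toAddSubgroup.map φ = Λ) {cc x₀ Y : M} (hx₀ : x₀ ≠ 0)
    (hΛx : ∀ x, x ∈ Λ ↔ ∃ z, IsOrd ρ α cc z ∧ x = x₀ * z) (hw₀Y : φ w₀ = Y⁻¹ * x₀)
    (hYO : IsOrd ρ α cc Y) (hYb : Valued.v Y = Valued.v (jE ϖ) ^ b) (hcb : Valued.v cc ≤ Valued.v (jE ϖ) ^ b)
    (u : GL (Fin 1) E) (ℓ₀ : ℕ) {m' : ℕ} (hLm : ℓ₀ + 1 ≤ m') (hum : Valued.v ((u : Matrix (Fin 1) (Fin 1) E) 0 0 - 1) ≤ Valued.v (ϖ ^ m'))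
    (hμ : Valued.v (lam - jE ((u : Matrix (Fin 1) (Fin 1) E) 0 0)) ≤ Valued.v (jE ϖ) ^ (2 * b + (ℓ₀ + 1)))
    (hanti : Valued.v ((lam - jE ((u : Matrix (Fin 1) (Fin 1) E) 0 0)) - ρ (lam - jE ((u : Matrix (Fin 1) (Fin 1) E) 0 0))) ≤
      Valued.v (cc * (α - ρ α)) * Valued.v (jE ϖ) ^ (b + (ℓ₀ + 1))) (mc : ℕ) :
    ¬ LatticeNearTransvShell ϖ ℓ₀ mc ((((endoGL (γ₂, u) : GL (Fin 3) E) : Matrix (Fin 3) (Fin 3) E) - 1)) L₃ := fun h =>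
  h.2.1 (latticeInLevel_endoGL_sub_one_of_deep_level hvρ hα hα1 hϖ jE hjv hjfix φ hφs hφi hφγ hb hpr hB hg₀ hg₀1 hprg hBΛ hx₀ hΛx hw₀Y hYO hYb hcb u (ℓ₀ + 1) hLm
    hum hμ hanti)
/-! ## §3 The lower anti-diagonal `j + b = jl′` (`2b < m₀`, `b < j`) sits on level EXACTLY `0` -/

/-- **THE ANTI-DIAGONAL DIGIT IS EXACT.**  `ρ` isometric, `ρα ≠ α`, `|α| ≤ 1`, `ρ(ϖE) = ϖE`, `|ϖ| = exp(−1)`, `|jE c| ≤ 1 ↔ |c| ≤ 1`; CELL `cc ≠ 0`, `Y ∈ 𝒪_cc`, `|Y| = |ϖE|^b`,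
`|cc| < |ϖE|^b` (`b < j`); ANTI-DIAGONAL letters `|μ| ≤ |ϖE|^{2b+1}` (below the row) and `|μ − ρμ| = |cc(α − ρα)|·|ϖE|^b` EXACTLY (`j + b = jl′`).  THEN
`¬ IsOrd ρ α cc (μ ∕ (ϖE·Y))`: the `B·P` term has size EXACTLY `|cc|·|ϖE|^{2b}` and dominates, so the level-1 token fails.
[cite: Serre1979, Ch. III §6 Prop. 12] [cite: Kottwitz1986BaseChangeUnits, §1 pp. 240–241] -/
theorem not_isOrd_div_mul_of_antidiagonal
    (hvρ : ∀ x, Valued.v (ρ x) = Valued.v x) (hα : ρ α ≠ α) (hα1 : Valued.v α ≤ 1)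
    (jE : E →+* M) (hjv : ∀ c, Valued.v (jE c) ≤ 1 ↔ Valued.v c ≤ 1) {ϖ : E} (hϖ : Valued.v ϖ = exp (-1 : ℤ)) (hρϖ : ρ (jE ϖ) = jE ϖ)
    {cc : M} (hc0 : cc ≠ 0) {Y : M} (hYO : IsOrd ρ α cc Y) {b : ℕ} (hYb : Valued.v Y = Valued.v (jE ϖ) ^ b) (hcb : Valued.v cc < Valued.v (jE ϖ) ^ b)
    {μ : M} (hμ : Valued.v μ ≤ Valued.v (jE ϖ) ^ (2 * b + 1)) (hanti : Valued.v (μ - ρ μ) = Valued.v (cc * (α - ρ α)) * Valued.v (jE ϖ) ^ b) :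
    ¬ IsOrd ρ α cc (μ / (jE ϖ * Y)) := by
  intro hO
  have hα0 : α - ρ α ≠ 0 := sub_ne_zero.2 (Ne.symm hα)
  have hvα0 : Valued.v (α - ρ α) ≠ 0 := (Valuation.ne_zero_iff _).2 hα0
  have hvαpos : 0 < Valued.v (α - ρ α) := zero_lt_iff.2 hvα0
  have hvϖ0 : Valued.v ϖ ≠ 0 := by rw [hϖ]; exact exp_ne_zero
  have hϖ0 : ϖ ≠ 0 := fun h0 => hvϖ0 (by rw [h0, map_zero])
  have hϖlt : Valued.v ϖ < 1 := by rw [hϖ, ← exp_zero, exp_lt_exp]; norm_num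
  have hjϖ0 : jE ϖ ≠ 0 := (map_ne_zero jE).2 hϖ0
  have hvjϖ0 : Valued.v (jE ϖ) ≠ 0 := (Valuation.ne_zero_iff _).2 hjϖ0
  have hvjϖpos : 0 < Valued.v (jE ϖ) := zero_lt_iff.2 hvjϖ0
  have hjϖlt : Valued.v (jE ϖ) < 1 := (v_map_lt_one_iff_of_le_iff jE hjv ϖ).2 hϖlt
  have hpbpos : 0 < Valued.v (jE ϖ) ^ b := pow_pos hvjϖpos _
  have hvc0 : Valued.v cc ≠ 0 := (Valuation.ne_zero_iff _).2 hc0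
  have hvcpos : 0 < Valued.v cc := zero_lt_iff.2 hvc0
  have hY0 : Y ≠ 0 := fun h0 => by
    rw [h0, Valuation.map_zero] at hYb
    exact pow_ne_zero b hvjϖ0 hYb.symm
  have hρY0 : ρ Y ≠ 0 := (map_ne_zero ρ).2 hY0
  -- the level-1 estimate carried by `hO`
  have hO2 : Valued.v (μ / Y - ρ (μ / Y)) ≤ Valued.v (cc * (α - ρ α)) * Valued.v (jE ϖ) := by
    have e : μ / (jE ϖ * Y) - ρ (μ / (jE ϖ * Y)) = (μ / Y - ρ (μ / Y)) / jE ϖ := by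
      rw [map_div₀, map_div₀, map_mul, hρϖ]
      field_simp
    have h := hO.2
    rwa [e, Valuation.map_div, div_le_iff₀ hvjϖpos] at h
  -- coordinates
  set B : M := (μ - ρ μ) / (α - ρ α) with hBdef
  set Q : M := (Y - ρ Y) / (α - ρ α) with hQdef
  set A : M := μ - B * α with hAdef
  set P : M := Y - Q * α with hPdef
  clear_value A P
  clear_value B Q
  have hvB : Valued.v B = Valued.v cc * Valued.v (jE ϖ) ^ b := by
    have h : Valued.v B * Valued.v (α - ρ α) = Valued.v cc * Valued.v (jE ϖ) ^ b * Valued.v (α - ρ α) := by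
      rw [hBdef, Valuation.map_div, div_mul_cancel₀ _ hvα0, hanti, Valuation.map_mul]; ac_rfl
    exact mul_right_cancel₀ hvα0 h
  have hvQ : Valued.v Q ≤ Valued.v cc := by
    rw [hQdef, Valuation.map_div, div_le_iff₀ hvαpos, ← Valuation.map_mul]
    exact hYO.2
  have hvP : Valued.v P = Valued.v (jE ϖ) ^ b := by
    have hlt : Valued.v (Q * α) < Valued.v Y := by
      rw [Valuation.map_mul, hYb]
      calc Valued.v Q * Valued.v α ≤ Valued.v cc * 1 := mul_le_mul' hvQ hα1
        _ = Valued.v cc := mul_one _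
        _ < Valued.v (jE ϖ) ^ b := hcb
    rw [hPdef, sub_eq_add_neg, Valuation.map_add_eq_of_lt_left _ (by rw [Valuation.map_neg]; exact hlt), hYb]
  have hBP : Valued.v (B * P) = Valued.v cc * Valued.v (jE ϖ) ^ (2 * b) := by
    rw [Valuation.map_mul, hvB, hvP, mul_assoc, ← pow_add, two_mul]
  have hvA : Valued.v A < Valued.v (jE ϖ) ^ (2 * b) := by
    rw [hAdef]
    refine lt_of_le_of_lt (Valuation.map_sub _ _ _) (max_lt ?_ ?_)
    · exact lt_of_le_of_lt hμ (pow_lt_pow_right_of_lt_one₀ hvjϖpos hjϖlt (by omega))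
    · rw [Valuation.map_mul, hvB]
      calc Valued.v cc * Valued.v (jE ϖ) ^ b * Valued.v α ≤ Valued.v cc * Valued.v (jE ϖ) ^ b * 1 := mul_le_mul_right hα1 _
        _ = Valued.v cc * Valued.v (jE ϖ) ^ b := mul_one _
        _ < Valued.v (jE ϖ) ^ b * Valued.v (jE ϖ) ^ b := mul_lt_mul_of_pos_right hcb hpbpos
        _ = Valued.v (jE ϖ) ^ (2 * b) := by rw [← pow_add, two_mul]
  have hdom : Valued.v (A * Q) < Valued.v (B * P) := by
    rw [hBP, Valuation.map_mul]
    calc Valued.v A * Valued.v Q ≤ Valued.v A * Valued.v cc := mul_le_mul_right hvQ _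
      _ < Valued.v (jE ϖ) ^ (2 * b) * Valued.v cc := mul_lt_mul_of_pos_right hvA hvcpos
      _ = Valued.v cc * Valued.v (jE ϖ) ^ (2 * b) := mul_comm _ _
  have hdiff : Valued.v (B * P - A * Q) = Valued.v cc * Valued.v (jE ϖ) ^ (2 * b) := by
    rw [sub_eq_add_neg, Valuation.map_add_eq_of_lt_left _ (by rw [Valuation.map_neg]; exact hdom), hBP]
  -- the identity and the contradiction `|ϖE|^{2b} ≤ |ϖE|^{2b+1}`
  have hident : μ / Y - ρ (μ / Y) = (B * P - A * Q) * (α - ρ α) / (Y * ρ Y) := by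
    rw [map_div₀, div_sub_div _ _ hY0 hρY0, mul_map_sub_mul_map_eq hα hBdef hAdef hQdef hPdef]
  rw [hident, Valuation.map_div, Valuation.map_mul, Valuation.map_mul, hvρ, hYb, div_le_iff₀ (mul_pos hpbpos hpbpos), hdiff, Valuation.map_mul] at hO2
  have hlt : Valued.v cc * Valued.v (α - ρ α) * Valued.v (jE ϖ) * (Valued.v (jE ϖ) ^ b * Valued.v (jE ϖ) ^ b) <
      Valued.v cc * Valued.v (jE ϖ) ^ (2 * b) * Valued.v (α - ρ α) :=
    calc Valued.v cc * Valued.v (α - ρ α) * Valued.v (jE ϖ) * (Valued.v (jE ϖ) ^ b * Valued.v (jE ϖ) ^ b)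
        = Valued.v (jE ϖ) ^ (2 * b + 1) * (Valued.v cc * Valued.v (α - ρ α)) := by rw [pow_succ, two_mul, pow_add]; ac_rfl
      _ < Valued.v (jE ϖ) ^ (2 * b) * (Valued.v cc * Valued.v (α - ρ α)) :=
          mul_lt_mul_of_pos_right (pow_lt_pow_right_of_lt_one₀ hvjϖpos hjϖlt (by omega)) (mul_pos hvcpos hvαpos)
      _ = Valued.v cc * Valued.v (jE ϖ) ^ (2 * b) * Valued.v (α - ρ α) := by ac_rfl
  exact absurd (lt_of_lt_of_le hlt hO2) (lt_irrefl _)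

/-- **HEAD — «THE LOWER ANTI-DIAGONAL SITS ON LEVEL EXACTLY ZERO»** (any `q`): ★ `…ShellLineModel`'s glued-vertex letters + `Fix ρ ⊇ jE(E)`; CELL `cc ≠ 0`, `hYO hYb`, `|cc| < |ϖE|^b`;
ANTI-DIAGONAL letters `hμ : |lam − jE u₀₀| ≤ |ϖE|^{2b+1}`, `hanti : |μ − ρμ| = |cc(α − ρα)|·|ϖE|^b`.  THEN `¬ LatticeInLevel ϖ 1 (Γ − 1) L₃` — so at odd `d` (`ℓ₀ = 1`) the
strip `j + b = jl′` carries no vertex of either label. [cite: Kottwitz1986BaseChangeUnits, §3] [cite: Serre1979, Ch. III §6 Prop. 12] [cite: Jacobowitz1962, §4] -/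
theorem not_latticeInLevel_one_endoGL_sub_one_of_antidiagonal
    (hvρ : ∀ x, Valued.v (ρ x) = Valued.v x) (hα : ρ α ≠ α) (hα1 : Valued.v α ≤ 1)
    {ϖ : E} (hϖ : Valued.v ϖ = exp (-1 : ℤ))
    (jE : E →+* M) (hjv : ∀ c, Valued.v (jE c) ≤ 1 ↔ Valued.v c ≤ 1) (hjfix : ∀ z, ρ z = z ↔ ∃ c, jE c = z)
    (φ : (Fin 2 → E) →+ M) (hφs : ∀ (c : E) (x : Fin 2 → E), φ (c • x) = jE c * φ x) (hφi : Function.Injective φ)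
    {γ₂ : GL (Fin 2) E} {lam : M} (hφγ : ∀ x, φ ((γ₂ : Matrix (Fin 2) (Fin 2) E) *ᵥ x) = lam * φ x)
    {L₃ : Submodule 𝒪[E] (Fin 3 → E)} {b : ℕ} (hb : ∀ a : E, (Pi.single 1 a : Fin 3 → E) ∈ L₃ ↔ Valued.v a ≤ Valued.v ϖ ^ b)
    (hpr : ∀ x ∈ L₃, Valued.v (x 1) * Valued.v ϖ ^ b ≤ 1)
    {B₂ : Submodule 𝒪[E] (Fin 2 → E)} {w₀ : Fin 2 → E} {g₀ : Fin 3 → E}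
    (hB : B₂.map ((Matrix.toLin' (!![1, 0; 0, 0; 0, 1] : Matrix (Fin 3) (Fin 2) E)).restrictScalars 𝒪[E]) =
      L₃ ⊓ LinearMap.ker ((LinearMap.proj (1 : Fin 3) : (Fin 3 → E) →ₗ[E] E).restrictScalars 𝒪[E]))
    (hg₀ : g₀ ∈ L₃) (hg₀1 : Valued.v (g₀ 1) * Valued.v ϖ ^ b = 1) (hprg : g₀ - Pi.single 1 (g₀ 1) = ![w₀ 0, 0, w₀ 1])
    {Λ : AddSubgroup M} (hBΛ : B₂.toAddSubgroup.map φ = Λ) {cc x₀ Y : M} (hc0 : cc ≠ 0) (hx₀ : x₀ ≠ 0)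
    (hΛx : ∀ x, x ∈ Λ ↔ ∃ z, IsOrd ρ α cc z ∧ x = x₀ * z) (hw₀Y : φ w₀ = Y⁻¹ * x₀)
    (hYO : IsOrd ρ α cc Y) (hYb : Valued.v Y = Valued.v (jE ϖ) ^ b) (hcb : Valued.v cc < Valued.v (jE ϖ) ^ b) (u : GL (Fin 1) E)
    (hμ : Valued.v (lam - jE ((u : Matrix (Fin 1) (Fin 1) E) 0 0)) ≤ Valued.v (jE ϖ) ^ (2 * b + 1))
    (hanti : Valued.v ((lam - jE ((u : Matrix (Fin 1) (Fin 1) E) 0 0)) - ρ (lam - jE ((u : Matrix (Fin 1) (Fin 1) E) 0 0))) =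
      Valued.v (cc * (α - ρ α)) * Valued.v (jE ϖ) ^ b) :
    ¬ LatticeInLevel ϖ 1 ((((endoGL (γ₂, u) : GL (Fin 3) E) : Matrix (Fin 3) (Fin 3) E) - 1)) L₃ := by
  have hvϖ0 : Valued.v ϖ ≠ 0 := by rw [hϖ]; exact exp_ne_zero
  have hjϖ0 : jE ϖ ≠ 0 := (map_ne_zero jE).2 (fun h0 => hvϖ0 (by rw [h0, map_zero]))
  have hρϖ : ρ (jE ϖ) = jE ϖ := (hjfix _).2 ⟨ϖ, rfl⟩
  have hY0 : Y ≠ 0 := fun h0 => by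
    rw [h0, Valuation.map_zero] at hYb
    exact pow_ne_zero b ((Valuation.ne_zero_iff _).2 hjϖ0) hYb.symm
  rw [latticeInLevel_endoGL_sub_one_iff_isOrd hvρ hϖ jE φ hφs hφi hφγ hb hpr hB hg₀ hg₀1 hprg hBΛ hx₀ hY0 hΛx hw₀Y u 1, pow_one, pow_one]
  rintro ⟨-, -, h3⟩
  exact not_isOrd_div_mul_of_antidiagonal hvρ hα hα1 jE hjv hϖ hρϖ hc0 hYO hYb hcb hμ hanti h3

/-- **HEAD — «AT ODD `d` THE STRIP `j + b = jl′` IS OFF THE SHELL»**: same letters; for every square level `mc`, `¬ LatticeNearTransvShell ϖ 1 mc (Γ − 1) L₃` (the shell asks the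
level-1 token, which fails). [cite: Kottwitz1986BaseChangeUnits, §3] [cite: Rogawski1990, §4.9 Prop. 4.9.1 (b) p. 55] -/
theorem not_latticeNearTransvShell_one_of_antidiagonal
    (hvρ : ∀ x, Valued.v (ρ x) = Valued.v x) (hα : ρ α ≠ α) (hα1 : Valued.v α ≤ 1)
    {ϖ : E} (hϖ : Valued.v ϖ = exp (-1 : ℤ))
    (jE : E →+* M) (hjv : ∀ c, Valued.v (jE c) ≤ 1 ↔ Valued.v c ≤ 1) (hjfix : ∀ z, ρ z = z ↔ ∃ c, jE c = z)
    (φ : (Fin 2 → E) →+ M) (hφs : ∀ (c : E) (x : Fin 2 → E), φ (c • x) = jE c * φ x) (hφi : Function.Injective φ)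
    {γ₂ : GL (Fin 2) E} {lam : M} (hφγ : ∀ x, φ ((γ₂ : Matrix (Fin 2) (Fin 2) E) *ᵥ x) = lam * φ x)
    {L₃ : Submodule 𝒪[E] (Fin 3 → E)} {b : ℕ} (hb : ∀ a : E, (Pi.single 1 a : Fin 3 → E) ∈ L₃ ↔ Valued.v a ≤ Valued.v ϖ ^ b)
    (hpr : ∀ x ∈ L₃, Valued.v (x 1) * Valued.v ϖ ^ b ≤ 1)
    {B₂ : Submodule 𝒪[E] (Fin 2 → E)} {w₀ : Fin 2 → E} {g₀ : Fin 3 → E}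
    (hB : B₂.map ((Matrix.toLin' (!![1, 0; 0, 0; 0, 1] : Matrix (Fin 3) (Fin 2) E)).restrictScalars 𝒪[E]) =
      L₃ ⊓ LinearMap.ker ((LinearMap.proj (1 : Fin 3) : (Fin 3 → E) →ₗ[E] E).restrictScalars 𝒪[E]))
    (hg₀ : g₀ ∈ L₃) (hg₀1 : Valued.v (g₀ 1) * Valued.v ϖ ^ b = 1) (hprg : g₀ - Pi.single 1 (g₀ 1) = ![w₀ 0, 0, w₀ 1])
    {Λ : AddSubgroup M} (hBΛ : B₂.toAddSubgroup.map φ = Λ) {cc x₀ Y : M} (hc0 : cc ≠ 0) (hx₀ : x₀ ≠ 0)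
    (hΛx : ∀ x, x ∈ Λ ↔ ∃ z, IsOrd ρ α cc z ∧ x = x₀ * z) (hw₀Y : φ w₀ = Y⁻¹ * x₀)
    (hYO : IsOrd ρ α cc Y) (hYb : Valued.v Y = Valued.v (jE ϖ) ^ b) (hcb : Valued.v cc < Valued.v (jE ϖ) ^ b) (u : GL (Fin 1) E)
    (hμ : Valued.v (lam - jE ((u : Matrix (Fin 1) (Fin 1) E) 0 0)) ≤ Valued.v (jE ϖ) ^ (2 * b + 1))
    (hanti : Valued.v ((lam - jE ((u : Matrix (Fin 1) (Fin 1) E) 0 0)) - ρ (lam - jE ((u : Matrix (Fin 1) (Fin 1) E) 0 0))) =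
      Valued.v (cc * (α - ρ α)) * Valued.v (jE ϖ) ^ b) (mc : ℕ) :
    ¬ LatticeNearTransvShell ϖ 1 mc ((((endoGL (γ₂, u) : GL (Fin 3) E) : Matrix (Fin 3) (Fin 3) E) - 1)) L₃ := fun h =>
  not_latticeInLevel_one_endoGL_sub_one_of_antidiagonal hvρ hα hα1 hϖ jE hjv hjfix φ hφs hφi hφγ hb hpr hB hg₀ hg₀1 hprg hBΛ hc0 hx₀ hΛx hw₀Y hYO hYb hcb u
    hμ hanti h.1

end Summit.HodgeConjecture.HodgeConjecture.Cruxes.H413.F0P3cDyRamDeepConeCellOffShellLevel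

end
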